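import Literature.Computability.Cryptography.HallgrenClassGroup

/-!
# Stub `stub_nagellData` of line `Sketch` (v4, Nagell planting) for the crux
`ArithStatLadder.IqThreeNotPPoly`

The line's sampler outputs `d = u · (u + 8) · (4u + 27)` with `u := G · t`,
`t = 1 + 11G + 11G² + 30Gj`. This stub extracts, from `Squarefree d` alone, that `−d` is a negative
fundamental discriminant and that `d` carries the Nagell data `y² + d = 4a³` with `1 < a`, `4a < d`,
`y` odd, namely `a = u + 9`, `y = 7u + 54`.

Mathematics.
* Key identity (a `ring` identity in `ℕ`, no subtraction):
  `(7u + 54)² + u (u + 8) (4u + 27) = 4 (u + 9)³`.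
* `u` is odd: if `u = 2v` then `u (u + 8) = 4 v (v + 4)`, so `2 · 2 ∣ d`, contradicting
  squarefreeness (`IsUnit 2` is false in `ℕ`). In particular `u ≥ 1`.
* With `u = 2v + 1`: `d = (2v + 1)(2v + 9)(8v + 31) = 4 · (8v³ + 71v² + 173v + 69) + 3 ≡ 3 (mod 4)`,
  so `−d ≡ 1 (mod 4)`, `−d` is squarefree and `≠ 1`: the first branch of `IsNegFundamentalDiscr`.
* `a = 2v + 10 > 1`, `4a = 8v + 40 ≤ 4 · (8v³ + 71v² + 173v + 69) < d`, and `y = 14v + 61` is odd.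
-/

set_option linter.dupNamespace false -- D-0017: single-problem summit ⇒ QuantumAdvantage.QuantumAdvantage by design

namespace Summit.QuantumAdvantage.QuantumAdvantage.Theorems.IqThreeNotPPoly

open Literature.Computability.Cryptography (IsNegFundamentalDiscr)

/-- Parity: if `u (u + 8) (4u + 27)` is squarefree then `u` is odd (for even `u = 2v` one has
`4 ∣ u (u + 8)`). -/
theorem nagellData_mod_two {u : ℕ} (hsq : Squarefree (u * (u + 8) * (4 * u + 27))) :
    u % 2 = 1 := by
  by_contra h
  obtain ⟨v, rfl⟩ : ∃ v, u = 2 * v := ⟨u / 2, by omega⟩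
  have h4 : 2 * 2 ∣ 2 * v * (2 * v + 8) * (4 * (2 * v) + 27) :=
    Dvd.intro (v * (v + 4) * (8 * v + 27)) (by ring)
  exact absurd (Nat.isUnit_iff.1 (hsq 2 h4)) (by norm_num)

/-- Core of the stub, in the variable `u`: if `d = u (u + 8) (4u + 27)` is squarefree then `−d` is
a negative fundamental discriminant and `(a, y) = (u + 9, 7u + 54)` is Nagell data for `d`:
`1 < a`, `4a < d`, `y² + d = 4a³`, `y` odd. -/
theorem nagellData_of_squarefree {u : ℕ} (hsq : Squarefree (u * (u + 8) * (4 * u + 27))) :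
    IsNegFundamentalDiscr (u * (u + 8) * (4 * u + 27)) ∧
    ∃ a y : ℕ, 1 < a ∧ 4 * a < u * (u + 8) * (4 * u + 27) ∧
      y ^ 2 + u * (u + 8) * (4 * u + 27) = 4 * a ^ 3 ∧ Odd y := by
  obtain ⟨v, rfl⟩ : ∃ v, u = 2 * v + 1 :=
    ⟨u / 2, by have h := nagellData_mod_two hsq; omega⟩
  obtain ⟨c, hc, hvc⟩ : ∃ c,
      (2 * v + 1) * (2 * v + 1 + 8) * (4 * (2 * v + 1) + 27) = 4 * c + 3 ∧ 2 * v + 10 ≤ c :=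
    ⟨8 * v ^ 3 + 71 * v ^ 2 + 173 * v + 69, by ring, by nlinarith⟩
  refine ⟨?_, 2 * v + 10, 14 * v + 61, by omega, by omega, by ring, ⟨7 * v + 30, by ring⟩⟩
  rw [hc] at hsq ⊢
  left
  refine ⟨?_, ?_, ?_⟩
  · push_cast
    omega
  · rw [← Int.squarefree_natAbs, Int.natAbs_neg, Int.natAbs_natCast]
    exact hsq
  · omega

/-- **Stub E · `stub_nagellData`.** For the line's sampler output
`d = u (u + 8) (4u + 27)`, `u = G · (1 + 11G + 11G² + 30Gj)`: if `d` is squarefree then `−d` is a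
negative fundamental discriminant (`d ≡ 3 (mod 4)`, squarefree) and `d` carries Nagell data
`y² + d = 4a³` with `1 < a`, `4a < d`, `y` odd (`a = u + 9`, `y = 7u + 54`). -/
theorem stub_nagellData :
    ∀ (G j : ℕ),
    Squarefree (G * (1 + 11 * G + 11 * G ^ 2 + 30 * G * j) *
      (G * (1 + 11 * G + 11 * G ^ 2 + 30 * G * j) + 8) *
      (4 * (G * (1 + 11 * G + 11 * G ^ 2 + 30 * G * j)) + 27)) →
    IsNegFundamentalDiscr (G * (1 + 11 * G + 11 * G ^ 2 + 30 * G * j) *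
      (G * (1 + 11 * G + 11 * G ^ 2 + 30 * G * j) + 8) *
      (4 * (G * (1 + 11 * G + 11 * G ^ 2 + 30 * G * j)) + 27)) ∧
    ∃ a y : ℕ, 1 < a ∧
      4 * a < G * (1 + 11 * G + 11 * G ^ 2 + 30 * G * j) *
        (G * (1 + 11 * G + 11 * G ^ 2 + 30 * G * j) + 8) *
        (4 * (G * (1 + 11 * G + 11 * G ^ 2 + 30 * G * j)) + 27) ∧
      y ^ 2 + G * (1 + 11 * G + 11 * G ^ 2 + 30 * G * j) *
        (G * (1 + 11 * G + 11 * G ^ 2 + 30 * G * j) + 8) *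
        (4 * (G * (1 + 11 * G + 11 * G ^ 2 + 30 * G * j)) + 27) = 4 * a ^ 3 ∧
      Odd y := by
  intro G j hsq
  exact nagellData_of_squarefree hsq

end Summit.QuantumAdvantage.QuantumAdvantage.Theorems.IqThreeNotPPoly
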